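import Summits.HodgeConjecture.HodgeConjecture.Theorems.Ring2WeilCoverageFrameFreePlacementD
import HarnessLib

/-!
# Weil-type family coverage — frame-free placement G: the first Weil-type TENFOLD with `ℚ(√-11)` through a group algebra

research route conditional on HC_CM; not a corollary; Q11.4-sentence-2 already refuted in dim ≥ 3.

Ring 2, WEIL-TYPE FAMILY-COVERAGE CENSUS (`HOME/WEIL-FAMILY-COVERAGE.md` `## b04`, block b04.11 P.S. 2, owner ring2-b04);
seventh part of `Ring2WeilCoverageFrameFreePlacement{,B,…,F}` (imports part D only).  The Schur-index-ONE window for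
`K = ℚ(√-11)`: `G = PSL₂(𝔽₁₁)` (order 660), whose two cuspidal characters `η₁, η₂` of degree 5 take the values
`(−1 ± √-11)/2` on the unipotent classes, so the `(η₁ ⊕ η₂)`-isotypic piece of any `G`-curve carries `ℚ(√-11)` through
the central element `x = (Σ_{u_A} g − Σ_{u_B} g)/12` (`x² = −11`).  The RIGID `G`-cover `(0; 3,3,5′)` (genus 45; two
conjugation orbits of generating triples; kit j185907, engine `psl2q.py`, 4861 s) has `m = 2` and `K`-signature `(5,5)` —
as the census's CLASS-NUMBER SIGNATURE LAW predicts (`#u_A = #u_B = 0`, `m = −10 + 4 + 4 + 4 = 2`) — i.e. its `η`-piece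
is an abelian TENFOLD OF WEIL TYPE `(5, ℚ(√-11))`, the first such object in the census carried by a curve with `K`
acting through a group algebra; its literal determinant is `det H = −576/161051 = −11·(24/1331)²`, so
`a = 576/11⁵ = 0² + 11·(24/1331)²` is a norm and the piece lies on the SPLIT row `W10.11.1` (THEOREM S1 of the census:
`d = 5` odd leaves `[a] = [det β]` free a priori; here it is trivial).

No `def`, no named fact, no `sorry`; nothing here is a statement about Hodge classes; `HC_CM` is used nowhere.

References: [cite: vanGeemen1994HodgeAV, 5.4 and (5.4.1)]; [cite: NavarroTiep2021, Thm. A1–A2].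
-/

noncomputable section

set_option linter.dupNamespace false

open Literature.AlgebraicGeometry.Motives
open Literature.AlgebraicGeometry.VanGeemen1994
open Summit.HodgeConjecture.HodgeConjecture.Ring2.Hypotheses

namespace Summit.HodgeConjecture.HodgeConjecture.Ring2.WeilCoverage

/-- **The rigid `PSL₂(𝔽₁₁)`-curve `(0; 3,3,5′)` (genus 45): its `(η₁ ⊕ η₂)`-piece is a Weil-type TENFOLD with `ℚ(√-11)`,
`K`-signature `(5,5)`, `det H = −576/161051`, `a = 576/11⁵ = 0² + 11·(24/1331)² ∈ Nm(ℚ(√-11)ˣ)`: row `W10.11.1` (split).**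
research route conditional on HC_CM; not a corollary; Q11.4-sentence-2 already refuted in dim ≥ 3. [cite: vanGeemen1994HodgeAV, (5.4.1)] -/
theorem tenfold_psl211_335_mk_detH_eq_split :
    (QuotientGroup.mk (Units.mk0 ((-576 : ℚ) / 161051) (by norm_num)) : weilNormResidueGroup 11) =
      splitDiscriminantClass 5 11 := by
  have e : Units.mk0 ((-576 : ℚ) / 161051) (by norm_num) = -(Units.mk0 ((576 : ℚ) / 161051) (by norm_num)) :=
    Units.ext (by norm_num)
  rw [e, mk_neg_eq_splitDiscriminantClass_iff_of_odd (n := 5) (by decide)]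
  exact mem_normUnitsSubgroup_of_sq_add_mul_sq _ (0 : ℚ) ((24 : ℚ) / 1331) (by norm_num)

/-- The same class stated positively: `[576/11⁵] = [1]`, i.e. `(−1)⁵·det H` is a norm from `ℚ(√-11)` — the tenfold's
component `(5, ℚ(√-11), [a])` is the one containing the split CM products `E⁵ × E′⁵`.
research route conditional on HC_CM; not a corollary; Q11.4-sentence-2 already refuted in dim ≥ 3. [cite: vanGeemen1994HodgeAV, (5.4.1)] -/
theorem tenfold_psl211_335_a_mem_norm :
    Units.mk0 ((576 : ℚ) / 161051) (by norm_num) ∈ normUnitsSubgroup ℚ (weilField 11) :=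
  mem_normUnitsSubgroup_of_sq_add_mul_sq _ (0 : ℚ) ((24 : ℚ) / 1331) (by norm_num)

end Summit.HodgeConjecture.HodgeConjecture.Ring2.WeilCoverage

end
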